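import Mathlib
import HarnessLib
import Summits.NavierStokesRegularity.NavierStokesRegularity.Theorems.AxisTwistDoorScalingToUnit
import Summits.NavierStokesRegularity.NavierStokesRegularity.Theorems.AxisTwistDoorAveragedConeLiouvilleFluxIteration

/-!
# Route `AxisTwistDoor`, crux `AveragedConeLiouville` (stmt-NavierStokesRegularity-26889), line `lrt_shell`, stub (5)
# `stub_fluxDecay` — brick F2: NAVIER–STOKES RESCALING of the line's objects and the reduction of flux decay to a
# ONE-SCALE CONTRACTION (Lei–Ren–Tian arXiv:2501.08976, §4 p. 12: "For any small r > 0, consider the rescaled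
# solution v^{(r)}(x,t) = r v(rx, r²t) with corresponding Γ^{(r)}(x,t) = Γ(rx, r²t). Clearly, both (cone) and (K)
# still hold for v^{(r)}. Repeating the arguments … we get (Gamma-sigma-r), or equivalently (Gamma-sigma-iter).")

* §1 the rescaled profile `nsRescale δ v = (s,y) ↦ δ v(δ²s, δy)` stays in the route's energy class with the SAME
  Type-I constant and the SAME Albritton–Barker quantity (`inClass_nsRescale`, `typeIBound_inClass_nsRescale`; tree:
  `scalingToUnit_proof`'s covariance lemmas), keeps the sign (`signE3_nsRescale`) and the slack-free cone with the SAME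
  constant `K` (`cone_nsRescale`), and its axis circulation is `Γ^{(δ)}(r,z,s) = Γ(δr, δz, δ²s)` (`circ_nsRescale`),
  `∮ω₃` and `∮|ω_h|` picking up one factor `δ` (`vortCirc_nsRescale`, `tiltCirc_nsRescale`);
* §2 `UnitContraction` — the ONE-SCALE statement that the shell mechanism must deliver (LRT eq. Gamma-sigma at scale 1,
  with constants depending only on the cone constant `K`, the Type-I constant `C`, a bound `I₀` for `𝐈` and the
  non-decay level `κ₀`) — and the reduction `fluxDecay_of_unitContraction : UnitContraction → (class + sign + global
  cone ⇒ FluxDecay)` by rescaling + brick F1 (`fluxDecay_of_scale_contraction`).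

Seat ns-atd-p1 (LEAD). WHAT THIS IS NOT: not a statement about Navier–Stokes regularity; `UnitContraction` is NOT
proved here (it is the analytic heart of stub (5)). Lands `--supports` the crux item as a helper.
-/

noncomputable section

-- the summit and its single sub-problem share the name (CONVENTIONS §1), as in every Theorems file
set_option linter.dupNamespace false

namespace Summit.NavierStokesRegularity.NavierStokesRegularity.Theorems.AxisTwistDoorAveragedConeLiouvilleRescale

open scoped InnerProductSpace ENNReal
open Set Function MeasureTheory Metric
open Literature.Analysis
open Literature.Analysis.FluidPDE hiding eR
open Summit.NavierStokesRegularity.NavierStokesRegularity.Theorems.AxisTwistDoorAveragedConeLiouvilleDefs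
open Summit.NavierStokesRegularity.NavierStokesRegularity.Theorems.AxisTwistDoorAveragedConeLiouvilleFluxIteration
open Summit.NavierStokesRegularity.NavierStokesRegularity.Theorems.AxisTwistDoorScalingToUnit
open Summit.NavierStokesRegularity.NavierStokesRegularity.Theorems.RellichScarSimilarityCovariance

variable {C : ℝ} {v : ℝ → EuclideanSpace ℝ (Fin 3) → EuclideanSpace ℝ (Fin 3)}
  {π : ℝ → EuclideanSpace ℝ (Fin 3) → ℝ}
  {H : ℝ → EuclideanSpace ℝ (Fin 3) → EuclideanSpace ℝ (Fin 3) →L[ℝ] EuclideanSpace ℝ (Fin 3)}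

/-! ### §1 Rescaling covariance of the line's objects -/

/-- The rescaled profile `(s,y) ↦ δ v(δ²s, δy)` is again in the route's energy class, with the Type-I constant
unchanged, pressure `δ² π(δ²s, δy)` and gradient `δ² H(δ²s, δy)`. -/
theorem inClass_nsRescale (h : InClass C v π H) {δ : ℝ} (hδ : 0 < δ) :
    InClass C (nsRescale δ v) (δ ^ 2 • stPull (δ ^ 2) δ 0 0 π) (δ ^ 2 • stPull (δ ^ 2) δ 0 0 H) := by
  refine ⟨h.decay.nsRescale hδ, continuousOn_uncurry_nsRescale_slab h.cont hδ, ?_, ?_,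
    isSuitableWeakSolutionOn_nsRescale h.suitable hδ, hasWeakSpatialGradientOn_nsRescale h.weakGrad hδ, ?_⟩
  · -- the Oseen identity (as in `scalingToUnit_proof`)
    intro s t hst ht x
    have hδ2 : 0 < δ ^ 2 := by positivity
    have hst' : δ ^ 2 * s < δ ^ 2 * t := mul_lt_mul_of_pos_left hst hδ2
    have ht' : δ ^ 2 * t < 0 := mul_neg_of_pos_of_neg hδ2 ht
    have key := h.mild (δ ^ 2 * s) (δ ^ 2 * t) hst' ht' (δ • x)
    rw [FluidPDE.nsRescale_eq_smul_stPull]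
    rw [heatExtension_smul_stPull hδ 0 (0 : EuclideanSpace ℝ (Fin 3)) v s (by linarith : 0 < t - s) x,
      oseenDuhamel_smul_stPull hδ 0 (0 : EuclideanSpace ℝ (Fin 3)) v hst.le x, smul_stPull_apply, zero_add,
      zero_add, zero_add, key, smul_sub, mul_sub]
  · intro t ht y
    rw [AxisTwistDoorScalingToUnit.nsRescale_slice, divergence_smul_comp_smul,
      h.divFree (δ ^ 2 * t) (mul_neg_of_pos_of_neg (by positivity) ht) (δ • y), mul_zero]
  · rw [typeIBound_nsRescale v π H hδ]; exact h.typeI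

/-- `𝐈` is scale invariant on the class. -/
theorem typeIBound_inClass_nsRescale {δ : ℝ} (hδ : 0 < δ) :
    typeIBound (Iio (0 : ℝ) ×ˢ univ) (nsRescale δ v) (δ ^ 2 • stPull (δ ^ 2) δ 0 0 π)
        (δ ^ 2 • stPull (δ ^ 2) δ 0 0 H) = typeIBound (Iio (0 : ℝ) ×ˢ univ) v π H :=
  typeIBound_nsRescale v π H hδ

/-- The sign `ω₃ ≥ 0` is scale invariant. -/
theorem signE3_nsRescale (h : SignE3 v) {δ : ℝ} (hδ : 0 < δ) : SignE3 (nsRescale δ v) := by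
  intro s hs y
  rw [curl_nsRescale_apply, real_inner_smul_left]
  exact mul_nonneg (by positivity) (h (δ ^ 2 * s) (mul_neg_of_pos_of_neg (by positivity) hs) (δ • y))

/-- `δ • cylPt r θ z = cylPt (δr) θ (δz)`. -/
theorem smul_cylPt (δ r θ z : ℝ) : δ • cylPt r θ z = cylPt (δ * r) θ (δ * z) :=
  smul_circlePoint δ r θ z

/-- The axis circulation is scale invariant: `Γ^{(δ)}(r,z,s) = Γ(δr, δz, δ²s)`. -/
theorem circ_nsRescale (v : ℝ → EuclideanSpace ℝ (Fin 3) → EuclideanSpace ℝ (Fin 3)) (δ r z s : ℝ) :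
    circ (nsRescale δ v) r z s = circ v (δ * r) (δ * z) (δ ^ 2 * s) := by
  unfold circ
  have e : (fun θ => ⟪nsRescale δ v s (cylPt r θ z), eT θ⟫_ℝ * r) =
      fun θ => ⟪v (δ ^ 2 * s) (cylPt (δ * r) θ (δ * z)), eT θ⟫_ℝ * (δ * r) := by
    funext θ
    rw [nsRescale_apply, smul_cylPt, real_inner_smul_left]
    ring
  rw [e]

/-- `∮ω₃ dl` picks up one factor `δ`: `vortCirc (v^{(δ)}) r z s = δ · vortCirc v (δr) (δz) (δ²s)`. -/
theorem vortCirc_nsRescale (v : ℝ → EuclideanSpace ℝ (Fin 3) → EuclideanSpace ℝ (Fin 3)) (δ r z s : ℝ) :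
    vortCirc (nsRescale δ v) r z s = δ * vortCirc v (δ * r) (δ * z) (δ ^ 2 * s) := by
  unfold vortCirc
  rw [← intervalIntegral.integral_const_mul]
  congr 1
  funext θ
  rw [curl_nsRescale_apply, smul_cylPt, real_inner_smul_left]
  ring

/-- `∮|ω_h| dl` picks up one factor `δ > 0`: `tiltCirc (v^{(δ)}) r z s = δ · tiltCirc v (δr) (δz) (δ²s)`. -/
theorem tiltCirc_nsRescale (v : ℝ → EuclideanSpace ℝ (Fin 3) → EuclideanSpace ℝ (Fin 3)) {δ : ℝ} (hδ : 0 < δ)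
    (r z s : ℝ) :
    tiltCirc (nsRescale δ v) r z s = δ * tiltCirc v (δ * r) (δ * z) (δ ^ 2 * s) := by
  unfold tiltCirc
  rw [← intervalIntegral.integral_const_mul]
  congr 1
  funext θ
  rw [curl_nsRescale_apply, smul_cylPt, real_inner_smul_left, ← smul_smul, ← smul_sub, norm_smul,
    Real.norm_of_nonneg (by positivity : (0 : ℝ) ≤ δ ^ 2)]
  ring

/-- The SLACK-FREE cone with constant `K` is scale invariant. -/
theorem cone_nsRescale {K : ℝ}
    (h : ∀ s : ℝ, s < 0 → ∀ r : ℝ, 0 < r → ∀ z : ℝ, tiltCirc v r z s ≤ K * vortCirc v r z s)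
    {δ : ℝ} (hδ : 0 < δ) :
    ∀ s : ℝ, s < 0 → ∀ r : ℝ, 0 < r → ∀ z : ℝ,
      tiltCirc (nsRescale δ v) r z s ≤ K * vortCirc (nsRescale δ v) r z s := by
  intro s hs r hr z
  rw [tiltCirc_nsRescale v hδ, vortCirc_nsRescale]
  have key := h (δ ^ 2 * s) (mul_neg_of_pos_of_neg (by positivity) hs) (δ * r) (mul_pos hδ hr) (δ * z)
  nlinarith

/-- A non-decay level met in every `𝒬(ρ)` for `v` is met in every `𝒬(ρ)` for `v^{(δ)}`. -/
theorem level_nsRescale {κ₀ : ℝ}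
    (h : ∀ ρ : ℝ, 0 < ρ → ∃ s r z : ℝ, -ρ ^ 2 < s ∧ s < 0 ∧ 0 < r ∧ r < ρ ∧ |z| < ρ ∧ κ₀ ≤ circ v r z s)
    {δ : ℝ} (hδ : 0 < δ) :
    ∀ ρ : ℝ, 0 < ρ → ∃ s r z : ℝ, -ρ ^ 2 < s ∧ s < 0 ∧ 0 < r ∧ r < ρ ∧ |z| < ρ ∧
      κ₀ ≤ circ (nsRescale δ v) r z s := by
  intro ρ hρ
  obtain ⟨s, r, z, hs, hs0, hr, hrρ, hz, hge⟩ := h (δ * ρ) (mul_pos hδ hρ)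
  refine ⟨s / δ ^ 2, r / δ, z / δ, ?_, ?_, ?_, ?_, ?_, ?_⟩
  · have hδ2 : 0 < δ ^ 2 := by positivity
    rw [lt_div_iff₀ hδ2]; nlinarith
  · exact div_neg_of_neg_of_pos hs0 (by positivity)
  · exact div_pos hr hδ
  · rw [div_lt_iff₀ hδ]; linarith
  · rw [abs_div, abs_of_pos hδ, div_lt_iff₀ hδ]; linarith
  · rw [circ_nsRescale]
    have e1 : δ * (r / δ) = r := by field_simp
    have e2 : δ * (z / δ) = z := by field_simp
    have e3 : δ ^ 2 * (s / δ ^ 2) = s := by field_simp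
    rw [e1, e2, e3]; exact hge

/-- A circulation bound on `𝒬(δρ)` for `v` is a bound on `𝒬(ρ)` for `v^{(δ)}`. -/
theorem circBoundOn_nsRescale {δ ρ M : ℝ} (hδ : 0 < δ) (h : CircBoundOn v (δ * ρ) M) :
    CircBoundOn (nsRescale δ v) ρ M := by
  intro s r z hs hs0 hr hrρ hz
  rw [circ_nsRescale]
  refine h _ _ _ ?_ ?_ (mul_pos hδ hr) ?_ ?_
  · have hδ2 : 0 < δ ^ 2 := by positivity
    nlinarith
  · exact mul_neg_of_pos_of_neg (by positivity) hs0
  · exact mul_lt_mul_of_pos_left hrρ hδ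
  · rw [abs_mul, abs_of_pos hδ]; exact mul_lt_mul_of_pos_left hz hδ

/-- A circulation bound on `𝒬(ρ)` for `v^{(δ)}` is a bound on `𝒬(δρ)` for `v`. -/
theorem circBoundOn_of_nsRescale {δ ρ M : ℝ} (hδ : 0 < δ) (h : CircBoundOn (nsRescale δ v) ρ M) :
    CircBoundOn v (δ * ρ) M := by
  intro s r z hs hs0 hr hrρ hz
  have key := h (s / δ ^ 2) (r / δ) (z / δ) ?_ ?_ ?_ ?_ ?_
  · rw [circ_nsRescale] at key
    have e1 : δ * (r / δ) = r := by field_simp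
    have e2 : δ * (z / δ) = z := by field_simp
    have e3 : δ ^ 2 * (s / δ ^ 2) = s := by field_simp
    rwa [e1, e2, e3] at key
  · have hδ2 : 0 < δ ^ 2 := by positivity
    rw [lt_div_iff₀ hδ2]; nlinarith
  · exact div_neg_of_neg_of_pos hs0 (by positivity)
  · exact div_pos hr hδ
  · rw [div_lt_iff₀ hδ]; linarith
  · rw [abs_div, abs_of_pos hδ, div_lt_iff₀ hδ]; linarith

/-! ### §2 The one-scale contraction and the reduction -/

/-- **The ONE-SCALE CONTRACTION** that the shell mechanism must deliver (LRT eq. Gamma-sigma at scale `1`, constants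
uniform in the profile): for a cone constant `K ≥ 0`, a Type-I constant `C`, a bound `I₀ < ∞` for `𝐈` and a
non-decay level `κ₀ > 0` there are `σ ∈ (0,1]` and `Γ*` such that EVERY class profile with these constants, the sign,
the slack-free cone with constant `K` and the level `κ₀` met in every `𝒬(ρ)` satisfies `Γ ≤ Γ*` on `𝒬(9/10)` and
the contraction "`Γ ≤ M` on `𝒬(9/10)` ⇒ `Γ ≤ (1−σ)M` on `𝒬(9/20)`". -/
def UnitContraction : Prop :=
  ∀ (K C : ℝ) (I₀ : ℝ≥0∞) (κ₀ : ℝ), 0 ≤ K → I₀ < ⊤ → 0 < κ₀ →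
    ∃ σ Γstar : ℝ, 0 < σ ∧ σ ≤ 1 ∧
      ∀ (w : ℝ → EuclideanSpace ℝ (Fin 3) → EuclideanSpace ℝ (Fin 3)) (ϖ : ℝ → EuclideanSpace ℝ (Fin 3) → ℝ)
        (G : ℝ → EuclideanSpace ℝ (Fin 3) → EuclideanSpace ℝ (Fin 3) →L[ℝ] EuclideanSpace ℝ (Fin 3)),
        InClass C w ϖ G → typeIBound (Iio (0 : ℝ) ×ˢ univ) w ϖ G ≤ I₀ → SignE3 w →
        (∀ s : ℝ, s < 0 → ∀ r : ℝ, 0 < r → ∀ z : ℝ, tiltCirc w r z s ≤ K * vortCirc w r z s) →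
        (∀ ρ : ℝ, 0 < ρ → ∃ s r z : ℝ, -ρ ^ 2 < s ∧ s < 0 ∧ 0 < r ∧ r < ρ ∧ |z| < ρ ∧ κ₀ ≤ circ w r z s) →
        CircBoundOn w (9 / 10) Γstar ∧
          ∀ M : ℝ, CircBoundOn w (9 / 10) M → CircBoundOn w (9 / 20) ((1 - σ) * M)

/-- **Brick F2 — flux decay from the one-scale contraction** (LRT §4 p. 12): rescale to every scale `ρ ≤ 1` (the class,
`𝐈`, the sign, the slack-free cone and the non-decay level are scale invariant, `Γ^{(ρ)}(r,z,s) = Γ(ρr,ρz,ρ²s)`) and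
iterate (brick F1). -/
theorem fluxDecay_of_unitContraction (hU : UnitContraction) :
    ∀ (C : ℝ) (v : ℝ → EuclideanSpace ℝ (Fin 3) → EuclideanSpace ℝ (Fin 3))
      (π : ℝ → EuclideanSpace ℝ (Fin 3) → ℝ)
      (H : ℝ → EuclideanSpace ℝ (Fin 3) → EuclideanSpace ℝ (Fin 3) →L[ℝ] EuclideanSpace ℝ (Fin 3)),
      InClass C v π H → SignE3 v → GlobalCone v → FluxDecay v := by
  intro C v π H hcl hsign hcone
  obtain ⟨K, hK0, hK⟩ := hcone
  refine fluxDecay_of_scale_contraction v fun κ₀ hκ₀ hlev => ?_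
  obtain ⟨σ, Γstar, hσ, hσ1, hunit⟩ := hU K C (typeIBound (Iio (0 : ℝ) ×ˢ univ) v π H) κ₀ hK0 hcl.typeI hκ₀
  refine ⟨σ, Γstar, hσ, hσ1, (hunit v π H hcl le_rfl hsign hK hlev).1, fun ρ hρ hρ1 M hM => ?_⟩
  -- contraction at scale `ρ` = unit-scale contraction for the rescaled profile `v^{(ρ)}`
  have hcl' := inClass_nsRescale hcl hρ
  have hI' : typeIBound (Iio (0 : ℝ) ×ˢ univ) (nsRescale ρ v) (ρ ^ 2 • stPull (ρ ^ 2) ρ 0 0 π)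
      (ρ ^ 2 • stPull (ρ ^ 2) ρ 0 0 H) ≤ typeIBound (Iio (0 : ℝ) ×ˢ univ) v π H :=
    (typeIBound_inClass_nsRescale hρ).le
  have h2 := (hunit (nsRescale ρ v) _ _ hcl' hI' (signE3_nsRescale hsign hρ) (cone_nsRescale hK hρ)
    (level_nsRescale hlev hρ)).2 M
  have hM' : CircBoundOn (nsRescale ρ v) (9 / 10) M := by
    have e : ρ * (9 / 10) = 9 * ρ / 10 := by ring
    have h1 : CircBoundOn v (ρ * (9 / 10)) M := by rw [e]; exact hM
    exact circBoundOn_nsRescale hρ h1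
  have h3 := circBoundOn_of_nsRescale hρ (h2 hM')
  have e : ρ * (9 / 20) = 9 * ρ / 20 := by ring
  rw [e] at h3
  exact h3

end Summit.NavierStokesRegularity.NavierStokesRegularity.Theorems.AxisTwistDoorAveragedConeLiouvilleRescale

end
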